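import Literature.NumberTheory.GaloisRepresentations.LubinTateColemanRelativeBaseChangeTwo
import Literature.NumberTheory.GaloisRepresentations.LubinTateComparisonPoints
import HarnessLib

/-!
# The moments `c_{β,k} = (D^k δβ)(0)` of a norm-coherent unit and their Frobenius twins are INVARIANT under enlarging the
# unramified base `E₁ ≤ E₂` (de Shalit I §3.5, I §3.12, III §1.3; `q = 2`)

Topic `NumberTheory/GaloisRepresentations` (theorems only; no definition, no named fact, no instance, no `sorry`).  Cell
`bsd-print-cf2`, width seat `bsd-line-cf2-p1-w8` g13, piece V1-enlarge of the `j = 0` seam values: the theta data of ONE label `𝔞`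
(coordinates of `𝔞`-division points) only live in a reading field `E₂ ⊇ E₁` LARGER than the frame's unramified base `E₁`, so the bridge
identities / the per-unit values are proved over `E₂` for the base-changed unit `ιβ = β.baseChange` (`LubinTateColemanRelativeBaseChangeTwo`:
`δ(ιβ) = ι(δβ)`), and must be transported back.  With de Shalit's invariant derivation `D = ω·d/dX` (`ω ∈ 𝒪_F⟦X⟧`, e.g. `ω = ω_f = invDiff`):

* ★ `iterate_mul_derivative_map` — `D_{S}^k (map φ g) = map φ (D_R^k g)` for
  `ω` with coefficients in a common base (`ω_S = map φ ω_R`);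
* ★★ `constantCoeff_iterate_relLogDerivSeries_baseChange` — **`c_{ιβ,k} = ι(c_{β,k})`** in `𝒪_{E₂}`;
* `unitBallToCBall_inclUnitBall` (`𝒪_{E₁} ⊆ 𝒪_{E₂} ⊆ 𝒪_{ℂ_F}` commute), `frobUnitBall_inclUnitBall` (`ι ∘ φ_{E₁} = φ_{E₂} ∘ ι`);
* ★★ `unitBallToCBall_moment_baseChange`, `unitBallToCBall_frob_moment_baseChange` — **read in `𝒪_{ℂ_F}`, the moments of `ιβ` over `E₂`
  and their Frobenius twins ARE those of `β` over `E₁`** — so any reading `Θ : 𝒪_{ℂ_F} → ℂ_p` gives the same values.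

No summit statement is proved; BSD is not proved by any of this.

## References
* [deShalit1987] E. de Shalit, *Iwasawa theory of elliptic curves with complex multiplication* (1987), I §3.5 (p. 18), I §3.12 (p. 23),
  III §1.3 (p. 92).
-/

noncomputable section

namespace Literature.NumberTheory.GaloisRepresentations

section MomentsBaseChange

open IsNonarchimedeanLocalField LubinTate ValuativeRel Field

/-! ## §1 `map` commutes with `d/dX` and with the iterates of `D = ω·d/dX` -/

/-- `map φ (g′) = (map φ g)′` for power series. [folklore] -/
private theorem map_derivative_eq {R S : Type*} [CommSemiring R] [CommSemiring S] (φ : R →+* S) (g : PowerSeries R) :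
    PowerSeries.map φ (PowerSeries.derivative R g) = PowerSeries.derivative S (PowerSeries.map φ g) := by
  ext n
  simp only [PowerSeries.coeff_map, PowerSeries.coeff_derivative, map_mul, map_add, map_natCast, map_one]

/-- ★ **`D^k` commutes with base change of the coefficients**: for `ω ∈ R⟦X⟧` and `D_R = ω·d/dX`, `D_S = (map φ ω)·d/dX`,
`D_S^k (map φ g) = map φ (D_R^k g)`. [cite: deShalit1987, I §3.5 (p. 18)] -/
theorem iterate_mul_derivative_map {R S : Type*} [CommSemiring R] [CommSemiring S] (φ : R →+* S) (ω g : PowerSeries R) (k : ℕ) :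
    (fun g' : PowerSeries S => PowerSeries.map φ ω * PowerSeries.derivative S g')^[k] (PowerSeries.map φ g) =
      PowerSeries.map φ ((fun g' : PowerSeries R => ω * PowerSeries.derivative R g')^[k] g) := by
  induction k with
  | zero => rfl
  | succ k ih =>
    rw [Function.iterate_succ_apply', Function.iterate_succ_apply', ih, map_mul, map_derivative_eq]

/-- The same with `ω` itself read from a common base `A`: `ω_R = map ι_R ω`, `ω_S = map ι_S ω`, `φ ∘ ι_R = ι_S`.
[cite: deShalit1987, I §3.5 (p. 18)] -/
theorem iterate_mul_derivative_map_of_comp {A R S : Type*} [CommSemiring A] [CommSemiring R] [CommSemiring S] (ιR : A →+* R)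
    (ιS : A →+* S) (φ : R →+* S) (hφ : φ.comp ιR = ιS) (ω : PowerSeries A) (g : PowerSeries R) (k : ℕ) :
    (fun g' : PowerSeries S => PowerSeries.map ιS ω * PowerSeries.derivative S g')^[k] (PowerSeries.map φ g) =
      PowerSeries.map φ ((fun g' : PowerSeries R => PowerSeries.map ιR ω * PowerSeries.derivative R g')^[k] g) := by
  rw [← iterate_mul_derivative_map φ (PowerSeries.map ιR ω) g k, ← RingHom.comp_apply (PowerSeries.map φ) (PowerSeries.map ιR),
    ← PowerSeries.map_comp, hφ]

/-! ## §2 The moments of a norm-coherent unit under `E₁ ≤ E₂` -/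

variable {F : Type} [Field F] [ValuativeRel F] [TopologicalSpace F] [IsNonarchimedeanLocalField F]

attribute [local instance] ltNormUniformSpace ltNormIsUniformAddGroup rk1 nF nE fintypeResidueField

variable {π : 𝒪[F]} (hπ : (valuation F).IsUniformizer (π : F))
  {E₁ E₂ : IntermediateField F (AlgebraicClosure F)} [FiniteDimensional F E₁] [FiniteDimensional F E₂] [Normal F E₁] [Normal F E₂]
  [IsGalois F E₁] [IsGalois F E₂] (hq : residueFieldCard F = 2) (h : E₁ ≤ E₂) (hE₂ : E₂ ≤ maxUnramified F)
  {σ₀ : absoluteGaloisGroup F} (hσ₀ : IsAbsArithFrob σ₀)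

/-- ★★ **`c_{ιβ,k} = ι(c_{β,k})`**: the `k`-th moment `(D^k δ)(0)` of the base-changed unit `ιβ` over `E₂` is the inclusion of that of
`β` over `E₁` (`δ(ιβ) = ι(δβ)`, `D^k ∘ map ι = map ι ∘ D^k`, `constantCoeff ∘ map ι = ι ∘ constantCoeff`), for ANY `ω ∈ (LTCoeff F)⟦X⟧`.
[cite: deShalit1987, I §3.12 (p. 23), III §1.3 (p. 92)] -/
theorem constantCoeff_iterate_relLogDerivSeries_baseChange (ω : PowerSeries (LTCoeff F)) (β : RelNormCoherentUnits hπ E₁) (k : ℕ) :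
    PowerSeries.constantCoeff ((fun g' : PowerSeries (unitBall E₂) =>
        PowerSeries.map (algebraMap (LTCoeff F) (unitBall E₂)) ω * PowerSeries.derivative (unitBall E₂) g')^[k]
        (relLogDerivSeries hπ E₂ hq hE₂ hσ₀ (β.baseChange hπ hq h hE₂ hσ₀))) =
      inclUnitBall (F := F) h (PowerSeries.constantCoeff ((fun g' : PowerSeries (unitBall E₁) =>
        PowerSeries.map (algebraMap (LTCoeff F) (unitBall E₁)) ω * PowerSeries.derivative (unitBall E₁) g')^[k]
        (relLogDerivSeries hπ E₁ hq (h.trans hE₂) hσ₀ β))) := by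
  rw [relLogDerivSeries_baseChange hπ hq h hE₂ hσ₀ β,
    iterate_mul_derivative_map_of_comp (algebraMap (LTCoeff F) (unitBall E₁)) (algebraMap (LTCoeff F) (unitBall E₂))
      (inclUnitBall (F := F) h : unitBall E₁ →+* unitBall E₂) ((inclUnitBall (F := F) h).comp_algebraMap) ω _ k,
    ← PowerSeries.coeff_zero_eq_constantCoeff_apply, PowerSeries.coeff_map, PowerSeries.coeff_zero_eq_constantCoeff_apply]
  rfl

omit [Normal F E₁] [Normal F E₂] [IsGalois F E₁] [IsGalois F E₂] in
/-- `𝒪_{E₁} ⊆ 𝒪_{E₂} ⊆ 𝒪_{ℂ_F}` commute: `unitBallToCBall E₂ ∘ ι = unitBallToCBall E₁` (the towers `k′(W_f)` inside `ℂ_F`).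
[cite: deShalit1987, III §1.3 (p. 92)] -/
theorem unitBallToCBall_inclUnitBall (x : unitBall E₁) :
    unitBallToCBall E₂ (inclUnitBall (F := F) h x) = unitBallToCBall E₁ x := by
  apply Subtype.ext
  rw [coe_unitBallToCBall, coe_unitBallToCBall, coe_inclUnitBall, IntermediateField.coe_inclusion]

omit [IsGalois F E₁] [IsGalois F E₂] in
/-- `ι ∘ φ_{E₁} = φ_{E₂} ∘ ι` on `𝒪_{E₁}` (both Frobenii are restrictions of the same `σ₀`). [cite: deShalit1987, I §1.1] -/
theorem frobUnitBall_inclUnitBall (σ₀ : absoluteGaloisGroup F) (x : unitBall E₁) :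
    (frobUnitBall E₂ σ₀ : unitBall E₂ →+* unitBall E₂) (inclUnitBall (F := F) h x) =
      inclUnitBall (F := F) h ((frobUnitBall E₁ σ₀ : unitBall E₁ →+* unitBall E₁) x) :=
  (inclUnitBall_unitBallEquiv_restrictNormal h σ₀ x).symm

/-- ★★ **The moments read in `𝒪_{ℂ_F}` are base-change invariant**: `unitBallToCBall E₂ (c_{ιβ,k}) = unitBallToCBall E₁ (c_{β,k})`.
[cite: deShalit1987, I §3.12 (p. 23), III §1.3 (p. 92)] -/
theorem unitBallToCBall_moment_baseChange (ω : PowerSeries (LTCoeff F)) (β : RelNormCoherentUnits hπ E₁) (k : ℕ) :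
    unitBallToCBall E₂ (PowerSeries.constantCoeff ((fun g' : PowerSeries (unitBall E₂) =>
        PowerSeries.map (algebraMap (LTCoeff F) (unitBall E₂)) ω * PowerSeries.derivative (unitBall E₂) g')^[k]
        (relLogDerivSeries hπ E₂ hq hE₂ hσ₀ (β.baseChange hπ hq h hE₂ hσ₀)))) =
      unitBallToCBall E₁ (PowerSeries.constantCoeff ((fun g' : PowerSeries (unitBall E₁) =>
        PowerSeries.map (algebraMap (LTCoeff F) (unitBall E₁)) ω * PowerSeries.derivative (unitBall E₁) g')^[k]
        (relLogDerivSeries hπ E₁ hq (h.trans hE₂) hσ₀ β))) := by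
  rw [constantCoeff_iterate_relLogDerivSeries_baseChange hπ hq h hE₂ hσ₀ ω β k, unitBallToCBall_inclUnitBall]

/-- ★★ **… and so are their Frobenius twins**: `unitBallToCBall E₂ (φ_{E₂} c_{ιβ,k}) = unitBallToCBall E₁ (φ_{E₁} c_{β,k})`.
[cite: deShalit1987, I §3.12 (p. 23), III §1.3 (p. 92)] -/
theorem unitBallToCBall_frob_moment_baseChange (ω : PowerSeries (LTCoeff F)) (β : RelNormCoherentUnits hπ E₁) (k : ℕ) :
    unitBallToCBall E₂ ((frobUnitBall E₂ σ₀ : unitBall E₂ →+* unitBall E₂)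
      (PowerSeries.constantCoeff ((fun g' : PowerSeries (unitBall E₂) =>
        PowerSeries.map (algebraMap (LTCoeff F) (unitBall E₂)) ω * PowerSeries.derivative (unitBall E₂) g')^[k]
        (relLogDerivSeries hπ E₂ hq hE₂ hσ₀ (β.baseChange hπ hq h hE₂ hσ₀))))) =
      unitBallToCBall E₁ ((frobUnitBall E₁ σ₀ : unitBall E₁ →+* unitBall E₁)
        (PowerSeries.constantCoeff ((fun g' : PowerSeries (unitBall E₁) =>
        PowerSeries.map (algebraMap (LTCoeff F) (unitBall E₁)) ω * PowerSeries.derivative (unitBall E₁) g')^[k]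
        (relLogDerivSeries hπ E₁ hq (h.trans hE₂) hσ₀ β)))) := by
  rw [constantCoeff_iterate_relLogDerivSeries_baseChange hπ hq h hE₂ hσ₀ ω β k, frobUnitBall_inclUnitBall,
    unitBallToCBall_inclUnitBall]

end MomentsBaseChange

end Literature.NumberTheory.GaloisRepresentations

end
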